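import Mathlib
import HarnessLib
import Summits.HubbardSuperconductivity.HubbardSuperconductivity.Theorems.KLProgrammeKLRegimeEnginePairTransferBudgetExplicitThreeTerm
import Summits.HubbardSuperconductivity.HubbardSuperconductivity.Theorems.KLProgrammeKLRegimeEnginePairTransferMassesFlat

/-!
# Route `KLProgramme` — ENGINE item stmt-HubbardSuperconductivity-20437 `KLRegimeEngineV17F2`, class #5 rev 3, (X).3 BUDGET ARITHMETIC — «88b» THE PINNED PAIR:
# the EXPLICIT PART of the reorganised `Ran` bound with the PINNED `D`-atoms is below a THREE-TERM MAJORANT — `klpp_explicit_le_threeTerm`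
# (cell gate-hubbard-kl, seat hubbard-kl-k3c1-p1 g17; twin of row 82 `klbd_explicit_le_threeTerm`; CLASS5-RESOLVED-STEP.md §17)

WHY.  On the pinned-pair spine (…Step7AnalyticResolvedConvRPinnedAll) the explicit part of `Ran` carries the two GUARDED `D`-atoms
`if [1 ≤ n ∧ j′ = n+1 ∧ window] then (KlamU)²·(z·4^{−(n+1)} + h·4^{−(n_β−n)} + w·2⁻ⁿ + l/L + t·min) else M4²·(interior slot | pinned edge slot | flat)`.
Each splits (`klpp_pin_if_le`, `klpp_pinx_if_le`: the window guards are `(x,y)`-dependent but COVERED by window ∨ tail, every piece is nonnegative) into a constant and a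
coefficient of the ROOM's `min` profile, both behind the SCALAR guard `1 ≤ n ∧ j′ = n+1`; so **explicit part ≤ C₀″ + c_d″·min_d + c_x″·min_x** with
`C₀″ = C₀[flat ↦ edge const at the pinned pair] + [pinned]·(KlamU)²(zD·4^{−(n+1)} + hD·4^{−(n_β−n)} + wD·2⁻ⁿ + lD/L) + (crossed twin, window-at-top-edge keeps the flat form)`,
`c_d″ = c_d + [pinned]·(M4²·K·32·8²·G² + (KlamU)²·tD)`, `c_x″ = c_x + [pinned]·(M4²·K′·32·16²·G² + (KlamU)²·tX)`.  Everything else is row 82 verbatim.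
Pure real arithmetic; nothing about the model's sizes is asserted; nothing asserts (X).3, (c), K3 or superconductivity.  0 kit · 0 lit.
-/

noncomputable section

namespace Summit.HubbardSuperconductivity.HubbardSuperconductivity.Theorems.KLRegimeSplit

set_option linter.dupNamespace false -- summit = problem name (single-conjunct summit), D-0017

open Finset Literature.MathematicalPhysics.QuantumLattice Literature.Probability.LatticeModels
open Literature.MathematicalPhysics.QuantumLattice.FermiRG
open Summit.HubbardSuperconductivity.HubbardSuperconductivity.Theorems.KLProgrammeLegKernels
open Summit.HubbardSuperconductivity.HubbardSuperconductivity.Theorems.TwoPointAssembly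
open Summit.HubbardSuperconductivity.HubbardSuperconductivity.Theorems.DispersionFlow
open Summit.HubbardSuperconductivity.HubbardSuperconductivity.Theorems.KLRegimeWick
open Summit.HubbardSuperconductivity.HubbardSuperconductivity.Theorems.EngineV8

/-! ## §1 Scalar splitting of the GUARDED pinned `D`-atoms -/

set_option maxHeartbeats 1600000 in
/-- The pinned DIRECT `D`-atom `if P₁ ∧ P₂ ∧ W then FIVE-SLOT else M·(slot | edge | flat)` splits as constant `+` coefficient·`mn`
(`W ∨ W'` covers, all pieces nonnegative). -/
theorem klpp_pin_if_le {P₁ P₂ W W' I : Prop} [Decidable P₁] [Decidable P₂] [Decidable W] [Decidable W'] [Decidable I]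
    (hcov : W ∨ W')
    {KU z a h b w c l d t mn M K κi κe e FL : ℝ} (h0 : 0 ≤ KU) (hz : 0 ≤ z) (ha : 0 ≤ a) (hh : 0 ≤ h) (hb : 0 ≤ b) (hw : 0 ≤ w) (hc : 0 ≤ c)
    (hl : 0 ≤ l) (hd : 0 ≤ d) (ht : 0 ≤ t) (hmn : 0 ≤ mn) (hM : 0 ≤ M) (hK : 0 ≤ K) (hκi : 0 ≤ κi) (hκe : 0 ≤ κe) (he : 0 ≤ e) (hFL : 0 ≤ FL) :
    (if P₁ ∧ P₂ ∧ W then KU * (z * a + h * b + w * c + l * d + t * mn)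
      else M * (if P₁ ∧ I then K * (κi * mn + e) else if P₁ ∧ P₂ ∧ W' then K * (κe * mn + e) else FL)) ≤
      (M * (if P₁ ∧ I then K * e else if P₁ ∧ P₂ then K * e else FL) + (if P₁ ∧ P₂ then KU * (z * a + h * b + w * c + l * d) else 0)) +
        (M * (if P₁ ∧ I then K * κi else if P₁ ∧ P₂ then K * κe else 0) + (if P₁ ∧ P₂ then KU * t else 0)) * mn := by
  have p1 : 0 ≤ M * (K * e) := mul_nonneg hM (mul_nonneg hK he)
  have p2 : 0 ≤ M * (K * κi) * mn := mul_nonneg (mul_nonneg hM (mul_nonneg hK hκi)) hmn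
  have p3 : 0 ≤ M * (K * κe) * mn := mul_nonneg (mul_nonneg hM (mul_nonneg hK hκe)) hmn
  have p4 : 0 ≤ M * FL := mul_nonneg hM hFL
  have p5 : 0 ≤ KU * (z * a + h * b + w * c + l * d) := mul_nonneg h0 (by positivity)
  have p6 : 0 ≤ KU * t * mn := mul_nonneg (mul_nonneg h0 ht) hmn
  by_cases h1 : P₁ <;> by_cases h2 : P₂ <;> by_cases hI : I <;> by_cases hW : W <;> by_cases hW' : W' <;>
    simp only [h1, h2, hI, hW, hW', and_true, and_false, and_self, if_true, if_false] <;>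
    first | exact (hcov.elim hW hW').elim | linarith [p1, p2, p3, p4, p5, p6]

set_option maxHeartbeats 1600000 in
/-- The pinned CROSSED `D`-atom (extra guard `B` = below the top edge; in the window at the top edge the flat form survives). -/
theorem klpp_pinx_if_le {P₁ P₂ W W' I B : Prop} [Decidable P₁] [Decidable P₂] [Decidable W] [Decidable W'] [Decidable I] [Decidable B]
    (hcov : W ∨ W')
    {KU z a h b w c l d t mn M K κi κe e FL : ℝ} (h0 : 0 ≤ KU) (hz : 0 ≤ z) (ha : 0 ≤ a) (hh : 0 ≤ h) (hb : 0 ≤ b) (hw : 0 ≤ w) (hc : 0 ≤ c)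
    (hl : 0 ≤ l) (hd : 0 ≤ d) (ht : 0 ≤ t) (hmn : 0 ≤ mn) (hM : 0 ≤ M) (hK : 0 ≤ K) (hκi : 0 ≤ κi) (hκe : 0 ≤ κe) (he : 0 ≤ e) (hFL : 0 ≤ FL) :
    (if P₁ ∧ P₂ ∧ B ∧ W then KU * (z * a + h * b + w * c + l * d + t * mn)
      else M * (if P₁ ∧ I ∧ B then K * (κi * mn + e) else if P₁ ∧ P₂ ∧ W' then K * (κe * mn + e) else FL)) ≤
      (M * (if P₁ ∧ I ∧ B then K * e else if P₁ ∧ P₂ then K * e + (if B then 0 else FL) else FL) + (if P₁ ∧ P₂ ∧ B then KU * (z * a + h * b + w * c + l * d) else 0)) +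
        (M * (if P₁ ∧ I ∧ B then K * κi else if P₁ ∧ P₂ then K * κe else 0) + (if P₁ ∧ P₂ ∧ B then KU * t else 0)) * mn := by
  have p1 : 0 ≤ M * (K * e) := mul_nonneg hM (mul_nonneg hK he)
  have p2 : 0 ≤ M * (K * κi) * mn := mul_nonneg (mul_nonneg hM (mul_nonneg hK hκi)) hmn
  have p3 : 0 ≤ M * (K * κe) * mn := mul_nonneg (mul_nonneg hM (mul_nonneg hK hκe)) hmn
  have p4 : 0 ≤ M * FL := mul_nonneg hM hFL
  have p5 : 0 ≤ KU * (z * a + h * b + w * c + l * d) := mul_nonneg h0 (by positivity)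
  have p6 : 0 ≤ KU * t * mn := mul_nonneg (mul_nonneg h0 ht) hmn
  by_cases h1 : P₁ <;> by_cases h2 : P₂ <;> by_cases hI : I <;> by_cases hB : B <;> by_cases hW : W <;> by_cases hW' : W' <;>
    simp only [h1, h2, hI, hB, hW, hW', and_true, and_false, and_self, if_true, if_false] <;>
    first | exact (hcov.elim hW hW').elim | linarith [p1, p2, p3, p4, p5, p6]

/-! ## §2 The explicit part below the three-term majorant (pinned-pair twin of row 82) -/

set_option maxHeartbeats 3200000 in
/-- **The explicit part of S12″'s `Ran` bound is below a three-term majorant** `C₀″ + c_d″·min_d + c_x″·min_x` — row 82 with the pinned `D`-atoms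
(the five-slot forward rows and the edge/tail slots join `C₀ c_d c_x` behind the scalar guard `1 ≤ n ∧ j′ = n+1`). -/
theorem klpp_explicit_le_threeTerm {L M : ℕ} [NeZero L] [NeZero M] (β μ U : ℝ) {P : SplitConsts} {R : RenConsts} (hGfr : 0 ≤ R.Gfr 1) {A2s : ℝ} (hA2s : 0 ≤ A2s) (hβ0 : 0 < β)
    (n j j' Ish : ℕ) (Qm : TorusSite 2 L) {M4 M6 M2 η4 η6 η2 mAU : ℝ} (hη44 : 0 ≤ η4 * M4 + M4 * η4)
    {zD hD wD lD tD zX hX wX lX tX : ℝ} (hz0 : (0 ≤ zD ∧ 0 ≤ hD ∧ 0 ≤ wD ∧ 0 ≤ lD ∧ 0 ≤ tD ∧ 0 ≤ zX ∧ 0 ≤ hX ∧ 0 ≤ wX ∧ 0 ≤ lX ∧ 0 ≤ tX)) (x y : TorusSite 2 L) :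
    (((if 1 ≤ n ∧ j' = n + 1 ∧ (4 + 8 / 3 * R.Gfr 1 * U ^ 2) * klTorusNorm L (x - y) < klScale klE0 (n + 1) / 8 then (P.Klam * U) ^ 2 * (zD * ((4 : ℝ) ^ (n + 1))⁻¹ + hD * ((4 : ℝ) ^ (nScales β - n))⁻¹ + wD * ((2 : ℝ) ^ n)⁻¹ + lD * ((L : ℝ))⁻¹ + tD * min (klTorusNorm L (x - y) / klScale klE0 (n + 1)) (klScale klE0 (n + 1) / klTorusNorm L (x - y))) else M4 * M4 * (if 1 ≤ n ∧ n + 2 ≤ j' then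
                    512 / 3 * (27 / (8 * Real.pi ^ 2)) * A2s * (16 * (klScale klE0 j' / klScale klE0 n)) / Real.pi * (10 + 50 * (4 + 8 / 3 * R.Gfr 1 * U ^ 2) * β / L) *
                      (72 * (4 + 8 / 3 * R.Gfr 1 * U ^ 2) ^ 2 * min (klTorusNorm L (x - y) / klScale klE0 (n + 1)) (klScale klE0 (n + 1) / klTorusNorm L (x - y)) + ((2 : ℝ) ^ n)⁻¹ / 4)
                  else if 1 ≤ n ∧ j' = n + 1 ∧ klScale klE0 (n + 1) / 8 ≤ (4 + 8 / 3 * R.Gfr 1 * U ^ 2) * klTorusNorm L (x - y) then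
                    512 / 3 * (27 / (8 * Real.pi ^ 2)) * A2s * (16 * (klScale klE0 j' / klScale klE0 n)) / Real.pi * (10 + 50 * (4 + 8 / 3 * R.Gfr 1 * U ^ 2) * β / L) *
                      (32 * 8 ^ 2 * (4 + 8 / 3 * R.Gfr 1 * U ^ 2) ^ 2 * min (klTorusNorm L (x - y) / klScale klE0 (n + 1)) (klScale klE0 (n + 1) / klTorusNorm L (x - y)) + ((2 : ℝ) ^ n)⁻¹ / 4)
                  else 2048 * klSoftMass L M β μ (klFlowFrameU L M β U μ (n + 1)) n (fun p => softSymbolCompl L M β μ (klFlowFrameU L M β U μ (n + 1)) (n + 1) j p - softSymbolCompl L M β μ (klFlowFrameU L M β U μ (n + 1)) (n + 1) j' p))) + (η4 * M4 + M4 * η4) * (if n = 0 then (2048 * 15367 : ℝ) else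
                  if (4 + 8 / 3 * R.Gfr 1 * U ^ 2) * klTorusNorm L (x - y) < klScale klE0 (n + 1) / 8 then (2048 * 15367 : ℝ) else
                    512 / 3 * (27 / (8 * Real.pi ^ 2)) * A2s * (16 / Real.pi) * (10 + 50 * (4 + 8 / 3 * R.Gfr 1 * U ^ 2) * β / L) *
                      (16384 * (4 + 8 / 3 * R.Gfr 1 * U ^ 2) ^ 2 * min (klTorusNorm L (x - y) / klScale klE0 (n + 1)) (klScale klE0 (n + 1) / klTorusNorm L (x - y)) + Real.sqrt 2 / 4 * ((2 : ℝ) ^ n)⁻¹)) + (if 1 ≤ n ∧ j' = n + 1 ∧ n + 3 ≤ nScales β ∧ (4 + 8 / 3 * R.Gfr 1 * U ^ 2) * klTorusNorm L (x + y - Qm) < klScale klE0 (n + 1) / 16 then (P.Klam * U) ^ 2 * (zX * ((4 : ℝ) ^ (n + 1))⁻¹ + hX * ((4 : ℝ) ^ (nScales β - n))⁻¹ + wX * ((2 : ℝ) ^ n)⁻¹ + lX * ((L : ℝ))⁻¹ + tX * min (klTorusNorm L (x + y - Qm) / klScale klE0 (n + 1)) (klScale klE0 (n + 1) / klTorusNorm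 L (x + y - Qm))) else M4 * M4 * (if 1 ≤ n ∧ n + 2 ≤ j' ∧ n + 3 ≤ nScales β then
                    256 / 3 * (27 / (8 * Real.pi ^ 2)) * A2s * (16 * (klScale klE0 j' / klScale klE0 n)) / Real.pi * (10 + 50 * (4 + 8 / 3 * R.Gfr 1 * U ^ 2) * β / L) *
                      (338 * (4 + 8 / 3 * R.Gfr 1 * U ^ 2) ^ 2 * min (klTorusNorm L (x + y - Qm) / klScale klE0 (n + 1)) (klScale klE0 (n + 1) / klTorusNorm L (x + y - Qm)) + ((2 : ℝ) ^ n)⁻¹ / 4)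
                  else if 1 ≤ n ∧ j' = n + 1 ∧ klScale klE0 (n + 1) / 16 ≤ (4 + 8 / 3 * R.Gfr 1 * U ^ 2) * klTorusNorm L (x + y - Qm) then
                    256 / 3 * (27 / (8 * Real.pi ^ 2)) * A2s * (16 * (klScale klE0 j' / klScale klE0 n)) / Real.pi * (10 + 50 * (4 + 8 / 3 * R.Gfr 1 * U ^ 2) * β / L) *
                      (32 * 16 ^ 2 * (4 + 8 / 3 * R.Gfr 1 * U ^ 2) ^ 2 * min (klTorusNorm L (x + y - Qm) / klScale klE0 (n + 1)) (klScale klE0 (n + 1) / klTorusNorm L (x + y - Qm)) + ((2 : ℝ) ^ n)⁻¹ / 4)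
                  else 1024 * klSoftMass L M β μ (klFlowFrameU L M β U μ (n + 1)) n (fun p => softSymbolCompl L M β μ (klFlowFrameU L M β U μ (n + 1)) (n + 1) j p - softSymbolCompl L M β μ (klFlowFrameU L M β U μ (n + 1)) (n + 1) j' p))) + (η4 * M4 + M4 * η4) * (if n = 0 then (1024 * 15367 : ℝ) else
                  if (4 + 8 / 3 * R.Gfr 1 * U ^ 2) * klTorusNorm L (x + y - Qm) < klScale klE0 (n + 1) / 8 then (1024 * 15367 : ℝ) else
                    256 / 3 * (27 / (8 * Real.pi ^ 2)) * A2s * (16 / Real.pi) * (10 + 50 * (4 + 8 / 3 * R.Gfr 1 * U ^ 2) * β / L) *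
                      (16384 * (4 + 8 / 3 * R.Gfr 1 * U ^ 2) ^ 2 * min (klTorusNorm L (x + y - Qm) / klScale klE0 (n + 1)) (klScale klE0 (n + 1) / klTorusNorm L (x + y - Qm)) + Real.sqrt 2 / 4 * ((2 : ℝ) ^ n)⁻¹)) + 2 * (M6 * M2 * (if n + 2 ≤ j' then (0 : ℝ) else 1024 * klSoftMass L M β μ (klFlowFrameU L M β U μ (n + 1)) n (fun p => softSymbolCompl L M β μ (klFlowFrameU L M β U μ (n + 1)) (n + 1) j p - softSymbolCompl L M β μ (klFlowFrameU L M β U μ (n + 1)) (n + 1) j' p)) + (η6 * M2 + M6 * η2) * (1024 * 15367 : ℝ))) +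
              2 * (mAU * (M4 * M4 * (if n = 0 then (2048 * 15367 : ℝ) * (4 * 61524 / Real.pi * ((4 : ℝ) ^ (j' - (n + 1)))⁻¹ * Real.pi) else
                  (2048 * 15367 : ℝ) * (4 * 61524 / Real.pi * ((4 : ℝ) ^ (j' - (n + 1)))⁻¹) * klScale klE0 (n + 1) + 512 / 3 * ((27 / (8 * Real.pi ^ 2)) * A2s * (16 / Real.pi) * (10 + 50 * (4 + 8 / 3 * R.Gfr 1 * U ^ 2) * β / L)) * (Real.sqrt 2 / 4 * ((2 : ℝ) ^ n)⁻¹) * (4 * 61524 / Real.pi * ((4 : ℝ) ^ (j' - (n + 1)))⁻¹ * Real.pi) +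
        2 * (4 * 61524 / Real.pi * ((4 : ℝ) ^ (j' - (n + 1)))⁻¹) * ((512 / 3 * ((27 / (8 * Real.pi ^ 2)) * A2s * (16 / Real.pi) * (10 + 50 * (4 + 8 / 3 * R.Gfr 1 * U ^ 2) * β / L)) * (16384 * (4 + 8 / 3 * R.Gfr 1 * U ^ 2) ^ 2) + (2048 * 15367 : ℝ) / (8 * (4 + 8 / 3 * R.Gfr 1 * U ^ 2))) * klScale klE0 (n + 1)) * Ish +
        (512 / 3 * ((27 / (8 * Real.pi ^ 2)) * A2s * (16 / Real.pi) * (10 + 50 * (4 + 8 / 3 * R.Gfr 1 * U ^ 2) * β / L)) * (16384 * (4 + 8 / 3 * R.Gfr 1 * U ^ 2) ^ 2) + (2048 * 15367 : ℝ) / (8 * (4 + 8 / 3 * R.Gfr 1 * U ^ 2))) * klScale klE0 (n + 1) * (4 * 61524 / Real.pi * ((4 : ℝ) ^ (j' - (n + 1)))⁻¹ * Real.pi) / (klScale klE0 (n + 1) * 2 ^ Ish)) + M4 * M4 * (if n = 0 then (1024 * 15367 : ℝ) * (4 * 61524 / Real.pi * ((4 : ℝ) ^ (j' - (n + 1)))⁻¹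 * Real.pi) else
                  (1024 * 15367 : ℝ) * (4 * 61524 / Real.pi * ((4 : ℝ) ^ (j' - (n + 1)))⁻¹) * klScale klE0 (n + 1) + 256 / 3 * ((27 / (8 * Real.pi ^ 2)) * A2s * (16 / Real.pi) * (10 + 50 * (4 + 8 / 3 * R.Gfr 1 * U ^ 2) * β / L)) * (Real.sqrt 2 / 4 * ((2 : ℝ) ^ n)⁻¹) * (4 * 61524 / Real.pi * ((4 : ℝ) ^ (j' - (n + 1)))⁻¹ * Real.pi) +
        2 * (4 * 61524 / Real.pi * ((4 : ℝ) ^ (j' - (n + 1)))⁻¹) * ((256 / 3 * ((27 / (8 * Real.pi ^ 2)) * A2s * (16 / Real.pi) * (10 + 50 * (4 + 8 / 3 * R.Gfr 1 * U ^ 2) * β / L)) * (16384 * (4 + 8 / 3 * R.Gfr 1 * U ^ 2) ^ 2) + (1024 * 15367 : ℝ) / (8 * (4 + 8 / 3 * R.Gfr 1 * U ^ 2))) * klScale klE0 (n + 1)) * Ish +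
        (256 / 3 * ((27 / (8 * Real.pi ^ 2)) * A2s * (16 / Real.pi) * (10 + 50 * (4 + 8 / 3 * R.Gfr 1 * U ^ 2) * β / L)) * (16384 * (4 + 8 / 3 * R.Gfr 1 * U ^ 2) ^ 2) + (1024 * 15367 : ℝ) / (8 * (4 + 8 / 3 * R.Gfr 1 * U ^ 2))) * klScale klE0 (n + 1) * (4 * 61524 / Real.pi * ((4 : ℝ) ^ (j' - (n + 1)))⁻¹ * Real.pi) / (klScale klE0 (n + 1) * 2 ^ Ish))))) ≤
      (M4 * M4 * (if 1 ≤ n ∧ n + 2 ≤ j' then 512 / 3 * (27 / (8 * Real.pi ^ 2)) * A2s * (16 * (klScale klE0 j' / klScale klE0 n)) / Real.pi * (10 + 50 * (4 + 8 / 3 * R.Gfr 1 * U ^ 2) * β / L) * (((2 : ℝ) ^ n)⁻¹ / 4) else if 1 ≤ n ∧ j' = n + 1 then 512 / 3 * (27 / (8 * Real.pi ^ 2)) * A2s * (16 * (klScale klE0 j' / klScale klE0 n)) / Real.pi * (10 + 50 * (4 + 8 / 3 * R.Gfr 1 * U ^ 2) * β / L) * (((2 : ℝ) ^ n)⁻¹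 / 4) else 2048 * klSoftMass L M β μ (klFlowFrameU L M β U μ (n + 1)) n (fun p => softSymbolCompl L M β μ (klFlowFrameU L M β U μ (n + 1)) (n + 1) j p - softSymbolCompl L M β μ (klFlowFrameU L M β U μ (n + 1)) (n + 1) j' p)) + (if 1 ≤ n ∧ j' = n + 1 then (P.Klam * U) ^ 2 * (zD * ((4 : ℝ) ^ (n + 1))⁻¹ + hD * ((4 : ℝ) ^ (nScales β - n))⁻¹ + wD * ((2 : ℝ) ^ n)⁻¹ + lD * ((L : ℝ))⁻¹) else 0) + (η4 * M4 + M4 * η4) * (if n = 0 then (2048 * 15367 : ℝ) else (2048 * 15367 : ℝ) + 512 / 3 * (27 / (8 * Real.pi ^ 2)) * A2s * (16 / Real.pi) * (10 + 50 * (4 + 8 / 3 * R.Gfr 1 * U ^ 2) * β / L) * (Real.sqrt 2 / 4 * ((2 : ℝ) ^ n)⁻¹)) + M4 * M4 * (if 1 ≤ n ∧ n + 2 ≤ j' ∧ n + 3 ≤ nScales β then 256 / 3 * (27 / (8 * Real.pi ^ 2)) * A2s * (16 * (klScale klE0 j' / klScale klE0 n)) / Real.pi * (10 + 50 * (4 +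 8 / 3 * R.Gfr 1 * U ^ 2) * β / L) * (((2 : ℝ) ^ n)⁻¹ / 4) else if 1 ≤ n ∧ j' = n + 1 then 256 / 3 * (27 / (8 * Real.pi ^ 2)) * A2s * (16 * (klScale klE0 j' / klScale klE0 n)) / Real.pi * (10 + 50 * (4 + 8 / 3 * R.Gfr 1 * U ^ 2) * β / L) * (((2 : ℝ) ^ n)⁻¹ / 4) + (if n + 3 ≤ nScales β then 0 else 1024 * klSoftMass L M β μ (klFlowFrameU L M β U μ (n + 1)) n (fun p => softSymbolCompl L M β μ (klFlowFrameU L M β U μ (n + 1)) (n + 1) j p - softSymbolCompl L M β μ (klFlowFrameU L M β U μ (n + 1)) (n + 1) j' p)) else 1024 * klSoftMass L M β μ (klFlowFrameU L M β U μ (n + 1)) n (fun p => softSymbolCompl L M β μ (klFlowFrameU L M β U μ (n + 1)) (n + 1) j p - softSymbolCompl L M β μ (klFlowFrameU L M β U μ (n + 1)) (n + 1) j' p)) + (if 1 ≤ n ∧ j' = n + 1 ∧ n + 3 ≤ nScales β then (P.Klam * U) ^ 2 * (zX * ((4 : ℝ) ^ (n + 1))⁻¹ + hX * ((4 : ℝ)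 ^ (nScales β - n))⁻¹ + wX * ((2 : ℝ) ^ n)⁻¹ + lX * ((L : ℝ))⁻¹) else 0) + (η4 * M4 + M4 * η4) * (if n = 0 then (1024 * 15367 : ℝ) else (1024 * 15367 : ℝ) + 256 / 3 * (27 / (8 * Real.pi ^ 2)) * A2s * (16 / Real.pi) * (10 + 50 * (4 + 8 / 3 * R.Gfr 1 * U ^ 2) * β / L) * (Real.sqrt 2 / 4 * ((2 : ℝ) ^ n)⁻¹)) +
              2 * (M6 * M2 * (if n + 2 ≤ j' then (0 : ℝ) else 1024 * klSoftMass L M β μ (klFlowFrameU L M β U μ (n + 1)) n (fun p => softSymbolCompl L M β μ (klFlowFrameU L M β U μ (n + 1)) (n + 1) j p - softSymbolCompl L M β μ (klFlowFrameU L M β U μ (n + 1)) (n + 1) j' p)) + (η6 * M2 + M6 * η2) * (1024 * 15367 : ℝ)) +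
              2 * (mAU * (M4 * M4 * (if n = 0 then (2048 * 15367 : ℝ) * (4 * 61524 / Real.pi * ((4 : ℝ) ^ (j' - (n + 1)))⁻¹ * Real.pi) else
                  (2048 * 15367 : ℝ) * (4 * 61524 / Real.pi * ((4 : ℝ) ^ (j' - (n + 1)))⁻¹) * klScale klE0 (n + 1) + 512 / 3 * ((27 / (8 * Real.pi ^ 2)) * A2s * (16 / Real.pi) * (10 + 50 * (4 + 8 / 3 * R.Gfr 1 * U ^ 2) * β / L)) * (Real.sqrt 2 / 4 * ((2 : ℝ) ^ n)⁻¹) * (4 * 61524 / Real.pi * ((4 : ℝ) ^ (j' - (n + 1)))⁻¹ * Real.pi) +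
        2 * (4 * 61524 / Real.pi * ((4 : ℝ) ^ (j' - (n + 1)))⁻¹) * ((512 / 3 * ((27 / (8 * Real.pi ^ 2)) * A2s * (16 / Real.pi) * (10 + 50 * (4 + 8 / 3 * R.Gfr 1 * U ^ 2) * β / L)) * (16384 * (4 + 8 / 3 * R.Gfr 1 * U ^ 2) ^ 2) + (2048 * 15367 : ℝ) / (8 * (4 + 8 / 3 * R.Gfr 1 * U ^ 2))) * klScale klE0 (n + 1)) * Ish +
        (512 / 3 * ((27 / (8 * Real.pi ^ 2)) * A2s * (16 / Real.pi) * (10 + 50 * (4 + 8 / 3 * R.Gfr 1 * U ^ 2) * β / L)) * (16384 * (4 + 8 / 3 * R.Gfr 1 * U ^ 2) ^ 2) + (2048 * 15367 : ℝ) / (8 * (4 + 8 / 3 * R.Gfr 1 * U ^ 2))) * klScale klE0 (n + 1) * (4 * 61524 / Real.pi * ((4 : ℝ) ^ (j' - (n + 1)))⁻¹ * Real.pi) / (klScale klE0 (n + 1) * 2 ^ Ish)) + M4 * M4 * (if n = 0 then (1024 * 15367 : ℝ) * (4 * 61524 / Real.pi * ((4 : ℝ) ^ (j' - (n + 1)))⁻¹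 * Real.pi) else
                  (1024 * 15367 : ℝ) * (4 * 61524 / Real.pi * ((4 : ℝ) ^ (j' - (n + 1)))⁻¹) * klScale klE0 (n + 1) + 256 / 3 * ((27 / (8 * Real.pi ^ 2)) * A2s * (16 / Real.pi) * (10 + 50 * (4 + 8 / 3 * R.Gfr 1 * U ^ 2) * β / L)) * (Real.sqrt 2 / 4 * ((2 : ℝ) ^ n)⁻¹) * (4 * 61524 / Real.pi * ((4 : ℝ) ^ (j' - (n + 1)))⁻¹ * Real.pi) +
        2 * (4 * 61524 / Real.pi * ((4 : ℝ) ^ (j' - (n + 1)))⁻¹) * ((256 / 3 * ((27 / (8 * Real.pi ^ 2)) * A2s * (16 / Real.pi) * (10 + 50 * (4 + 8 / 3 * R.Gfr 1 * U ^ 2) * β / L)) * (16384 * (4 + 8 / 3 * R.Gfr 1 * U ^ 2) ^ 2) + (1024 * 15367 : ℝ) / (8 * (4 + 8 / 3 * R.Gfr 1 * U ^ 2))) * klScale klE0 (n + 1)) * Ish +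
        (256 / 3 * ((27 / (8 * Real.pi ^ 2)) * A2s * (16 / Real.pi) * (10 + 50 * (4 + 8 / 3 * R.Gfr 1 * U ^ 2) * β / L)) * (16384 * (4 + 8 / 3 * R.Gfr 1 * U ^ 2) ^ 2) + (1024 * 15367 : ℝ) / (8 * (4 + 8 / 3 * R.Gfr 1 * U ^ 2))) * klScale klE0 (n + 1) * (4 * 61524 / Real.pi * ((4 : ℝ) ^ (j' - (n + 1)))⁻¹ * Real.pi) / (klScale klE0 (n + 1) * 2 ^ Ish))))) +
        (M4 * M4 * (if 1 ≤ n ∧ n + 2 ≤ j' then 512 / 3 * (27 / (8 * Real.pi ^ 2)) * A2s * (16 * (klScale klE0 j' / klScale klE0 n)) / Real.pi * (10 + 50 * (4 + 8 / 3 * R.Gfr 1 * U ^ 2) * β / L) * (72 * (4 + 8 / 3 * R.Gfr 1 * U ^ 2) ^ 2) else if 1 ≤ n ∧ j' = n + 1 then 512 / 3 * (27 / (8 * Real.pi ^ 2)) * A2s * (16 * (klScale klE0 j' / klScale klE0 n)) / Real.pi * (10 + 50 * (4 + 8 / 3 * R.Gfr 1 * U ^ 2) * β / L) * (32 * 8 ^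 2 * (4 + 8 / 3 * R.Gfr 1 * U ^ 2) ^ 2) else 0) + (if 1 ≤ n ∧ j' = n + 1 then (P.Klam * U) ^ 2 * tD else 0) + (η4 * M4 + M4 * η4) * (if n = 0 then (0 : ℝ) else 512 / 3 * (27 / (8 * Real.pi ^ 2)) * A2s * (16 / Real.pi) * (10 + 50 * (4 + 8 / 3 * R.Gfr 1 * U ^ 2) * β / L) * (16384 * (4 + 8 / 3 * R.Gfr 1 * U ^ 2) ^ 2))) *
          min (klTorusNorm L (x - y) / klScale klE0 (n + 1)) (klScale klE0 (n + 1) / klTorusNorm L (x - y)) +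
        (M4 * M4 * (if 1 ≤ n ∧ n + 2 ≤ j' ∧ n + 3 ≤ nScales β then 256 / 3 * (27 / (8 * Real.pi ^ 2)) * A2s * (16 * (klScale klE0 j' / klScale klE0 n)) / Real.pi * (10 + 50 * (4 + 8 / 3 * R.Gfr 1 * U ^ 2) * β / L) * (338 * (4 + 8 / 3 * R.Gfr 1 * U ^ 2) ^ 2) else if 1 ≤ n ∧ j' = n + 1 then 256 / 3 * (27 / (8 * Real.pi ^ 2)) * A2s * (16 * (klScale klE0 j' / klScale klE0 n)) / Real.pi * (10 + 50 * (4 + 8 / 3 * R.Gfr 1 * U ^ 2) * β / L) * (32 * 16 ^ 2 * (4 + 8 / 3 * R.Gfr 1 * U ^ 2) ^ 2) else 0) + (if 1 ≤ n ∧ j' = n + 1 ∧ n + 3 ≤ nScales β then (P.Klam * U) ^ 2 * tX else 0) + (η4 * M4 + M4 * η4) * (if n = 0 then (0 : ℝ) else 256 / 3 * (27 / (8 * Real.pi ^ 2)) * A2s * (16 / Real.pi) * (10 + 50 * (4 + 8 / 3 * R.Gfr 1 * U ^ 2) * β / L) * (16384 * (4 + 8 / 3 * R.Gfr 1 * U ^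 2) ^ 2))) *
          min (klTorusNorm L (x + y - Qm) / klScale klE0 (n + 1)) (klScale klE0 (n + 1) / klTorusNorm L (x + y - Qm)) := by
  have hL0 : (0 : ℝ) < L := Nat.cast_pos.2 (Nat.pos_of_ne_zero (NeZero.ne L))
  have hG : 0 ≤ (4 + 8 / 3 * R.Gfr 1 * U ^ 2) := by nlinarith [sq_nonneg U]
  have hΛ : ∀ i : ℕ, 0 ≤ klScale klE0 i := fun i => by unfold klScale klE0; positivity
  have hmd : 0 ≤ min (klTorusNorm L (x - y) / klScale klE0 (n + 1)) (klScale klE0 (n + 1) / klTorusNorm L (x - y)) := le_min (div_nonneg (torusSupNorm_nonneg _) (hΛ _)) (div_nonneg (hΛ _) (torusSupNorm_nonneg _))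
  have hmx : 0 ≤ min (klTorusNorm L (x + y - Qm) / klScale klE0 (n + 1)) (klScale klE0 (n + 1) / klTorusNorm L (x + y - Qm)) := le_min (div_nonneg (torusSupNorm_nonneg _) (hΛ _)) (div_nonneg (hΛ _) (torusSupNorm_nonneg _))
  have hM : 0 ≤ M4 * M4 := mul_self_nonneg M4
  have hbr : 0 ≤ 10 + 50 * (4 + 8 / 3 * R.Gfr 1 * U ^ 2) * β / L := by positivity
  have hKp : 0 ≤ 512 / 3 * (27 / (8 * Real.pi ^ 2)) * A2s * (16 / Real.pi) * (10 + 50 * (4 + 8 / 3 * R.Gfr 1 * U ^ 2) * β / L) := by positivity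
  have hKp' : 0 ≤ 256 / 3 * (27 / (8 * Real.pi ^ 2)) * A2s * (16 / Real.pi) * (10 + 50 * (4 + 8 / 3 * R.Gfr 1 * U ^ 2) * β / L) := by positivity
  have hG2 : 0 ≤ (4 + 8 / 3 * R.Gfr 1 * U ^ 2) ^ 2 := sq_nonneg _
  have hE1 : (0 : ℝ) ≤ ((2 : ℝ) ^ n)⁻¹ / 4 := by positivity
  have hE2 : (0 : ℝ) ≤ Real.sqrt 2 / 4 * ((2 : ℝ) ^ n)⁻¹ := by positivity
  obtain ⟨hzD, hhD, hwD, hlD, htD, hzX, hhX, hwX, hlX, htX⟩ := hz0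
  have hKU : 0 ≤ (P.Klam * U) ^ 2 := sq_nonneg _
  have h4i : 0 ≤ ((4 : ℝ) ^ (n + 1))⁻¹ := by positivity
  have h4t : 0 ≤ ((4 : ℝ) ^ (nScales β - n))⁻¹ := by positivity
  have h2i : 0 ≤ ((2 : ℝ) ^ n)⁻¹ := by positivity
  have hLi : 0 ≤ ((L : ℝ))⁻¹ := by positivity
  have hΛn := hΛ n; have hΛj := hΛ j'
  have hKd : 0 ≤ 512 / 3 * (27 / (8 * Real.pi ^ 2)) * A2s * (16 * (klScale klE0 j' / klScale klE0 n)) / Real.pi * (10 + 50 * (4 + 8 / 3 * R.Gfr 1 * U ^ 2) * β / L) := by positivity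
  have hKx : 0 ≤ 256 / 3 * (27 / (8 * Real.pi ^ 2)) * A2s * (16 * (klScale klE0 j' / klScale klE0 n)) / Real.pi * (10 + 50 * (4 + 8 / 3 * R.Gfr 1 * U ^ 2) * β / L) := by positivity
  have hSM := klSoftMass_nonneg β μ (klFlowFrameU L M β U μ (n + 1)) hβ0 n (fun p => softSymbolCompl L M β μ (klFlowFrameU L M β U μ (n + 1)) (n + 1) j p - softSymbolCompl L M β μ (klFlowFrameU L M β U μ (n + 1)) (n + 1) j' p)
  have h1 := klpp_pin_if_le (P₁ := 1 ≤ n) (P₂ := j' = n + 1) (I := n + 2 ≤ j')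
    (W := (4 + 8 / 3 * R.Gfr 1 * U ^ 2) * klTorusNorm L (x - y) < klScale klE0 (n + 1) / 8) (W' := klScale klE0 (n + 1) / 8 ≤ (4 + 8 / 3 * R.Gfr 1 * U ^ 2) * klTorusNorm L (x - y))
    (lt_or_ge _ _) hKU hzD h4i hhD h4t hwD h2i hlD hLi htD hmd hM hKd (by positivity : (0 : ℝ) ≤ 72 * (4 + 8 / 3 * R.Gfr 1 * U ^ 2) ^ 2)
    (by positivity : (0 : ℝ) ≤ 32 * 8 ^ 2 * (4 + 8 / 3 * R.Gfr 1 * U ^ 2) ^ 2) hE1 (mul_nonneg (by norm_num : (0 : ℝ) ≤ 2048) hSM)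
  have h2 := klbd_prof_if_le (n := n) ((4 + 8 / 3 * R.Gfr 1 * U ^ 2) * klTorusNorm L (x - y) < klScale klE0 (n + 1) / 8) (by norm_num : (0 : ℝ) ≤ 2048 * 15367) hKp
    (by positivity : (0 : ℝ) ≤ 16384 * (4 + 8 / 3 * R.Gfr 1 * U ^ 2) ^ 2) hmd hE2
  have h3 := klpp_pinx_if_le (P₁ := 1 ≤ n) (P₂ := j' = n + 1) (I := n + 2 ≤ j') (B := n + 3 ≤ nScales β)
    (W := (4 + 8 / 3 * R.Gfr 1 * U ^ 2) * klTorusNorm L (x + y - Qm) < klScale klE0 (n + 1) / 16) (W' := klScale klE0 (n + 1) / 16 ≤ (4 + 8 / 3 * R.Gfr 1 * U ^ 2) * klTorusNorm L (x + y - Qm))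
    (lt_or_ge _ _) hKU hzX h4i hhX h4t hwX h2i hlX hLi htX hmx hM hKx (by positivity : (0 : ℝ) ≤ 338 * (4 + 8 / 3 * R.Gfr 1 * U ^ 2) ^ 2)
    (by positivity : (0 : ℝ) ≤ 32 * 16 ^ 2 * (4 + 8 / 3 * R.Gfr 1 * U ^ 2) ^ 2) hE1 (mul_nonneg (by norm_num : (0 : ℝ) ≤ 1024) hSM)
  have h4 := klbd_prof_if_le (n := n) ((4 + 8 / 3 * R.Gfr 1 * U ^ 2) * klTorusNorm L (x + y - Qm) < klScale klE0 (n + 1) / 8) (by norm_num : (0 : ℝ) ≤ 1024 * 15367) hKp'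
    (by positivity : (0 : ℝ) ≤ 16384 * (4 + 8 / 3 * R.Gfr 1 * U ^ 2) ^ 2) hmx hE2
  have g1 := h1
  have g2 := mul_le_mul_of_nonneg_left h2 hη44
  have g3 := h3
  have g4 := mul_le_mul_of_nonneg_left h4 hη44
  refine (add_le_add (add_le_add (add_le_add (add_le_add (add_le_add g1 g2) g3) g4) le_rfl) le_rfl).trans (le_of_eq ?_)
  ring

end Summit.HubbardSuperconductivity.HubbardSuperconductivity.Theorems.KLRegimeSplit

end
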